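import Mathlib

/-!
# One block carries the loop (crux `LaminatedThreshold`, idea card `horizon-shadowed-bag`, s3d)

Support lemmas for the round-2 idea card `Cruxes/LaminatedThreshold/Ideas/horizon-shadowed-bag.md`
of crux A (`Theses.LaminatedThreshold.LaminatedThreshold`, item `stmt-FinalStateConjecture-16893`),
step (s3d) of its stub S3 `ShadowedBagNotSettled`: *"a late essential loop at bounded `T` meets
only finitely many compact blocks `chart i '' {τ₁ ≤ t* ≤ τ₂, r ≤ R}`, pairwise disjoint closed
sets, hence by connectedness lies in ONE block, the homeomorphic image of a simply connected set —
contradiction with essentiality"*. The topology of that step, free of all GR objects: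

* `subset_of_subset_iUnion_of_pairwise_disjoint_isClosed` — a nonempty preconnected set covered by
  finitely many pairwise disjoint closed sets lies in one of them;
* `Path.Homotopic.refl_of_range_subset_range_of_isEmbedding` — a loop inside the image of an
  EMBEDDING of a simply connected space is null-homotopic (in the ambient space);
* `Path.Homotopic.refl_of_range_subset_iUnion` — hence a loop covered by finitely many pairwise
  disjoint closed "blocks", each of which kills the loops it contains (e.g. embedded images of
  simply connected spaces, `…_of_isEmbedding`), is null-homotopic: it is NOT essential.

Proofs: `isPreconnected_iff_subset_of_disjoint_closed` with `u = F i₀`, `v = ⋃_{j ≠ i₀} F j`;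
transport of the loop through `IsEmbedding.toHomeomorph` and `SimplyConnectedSpace.paths_homotopic`,
pushed forward by `Path.Homotopic.map`. [folklore; A. Hatcher, *Algebraic Topology*, §1.1,
Prop. 1.6 and the functoriality remarks p. 34]
-/

open Set Topology

set_option linter.dupNamespace false

namespace Summit.FinalStateConjecture.FinalStateConjecture.Theorems.LaminatedThreshold.HorizonShadowedBag

variable {X : Type*} [TopologicalSpace X]

/-- **One block carries a connected set**: a nonempty preconnected set covered by finitely many
pairwise disjoint closed sets lies in one of them (`u = F i₀ ∋ x`, `v =` the union of the others,
`isPreconnected_iff_subset_of_disjoint_closed`). [folklore] -/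
theorem subset_of_subset_iUnion_of_pairwise_disjoint_isClosed {ι : Type*} [Finite ι]
    {s : Set X} (hs : IsPreconnected s) (hne : s.Nonempty) {F : ι → Set X}
    (hF : ∀ i, IsClosed (F i)) (hdisj : Pairwise (Function.onFun Disjoint F))
    (hcov : s ⊆ ⋃ i, F i) : ∃ i, s ⊆ F i := by
  classical
  obtain ⟨x, hx⟩ := hne
  obtain ⟨i₀, hi₀⟩ := mem_iUnion.1 (hcov hx)
  refine ⟨i₀, ?_⟩
  set v : Set X := ⋃ j ∈ {j | j ≠ i₀}, F j with hv
  have hvc : IsClosed v := (Set.toFinite _).isClosed_biUnion fun j _ ↦ hF j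
  have hsub : s ⊆ F i₀ ∪ v := by
    intro y hy
    obtain ⟨j, hj⟩ := mem_iUnion.1 (hcov hy)
    by_cases hji : j = i₀
    · exact Or.inl (hji ▸ hj)
    · exact Or.inr (mem_biUnion (show j ∈ {j | j ≠ i₀} from hji) hj)
  have hint : s ∩ (F i₀ ∩ v) = ∅ := by
    refine eq_empty_of_forall_notMem fun y ⟨_, hy₀, hyv⟩ ↦ ?_
    obtain ⟨j, hj, hyj⟩ := mem_iUnion₂.1 hyv
    exact Set.disjoint_left.1 (hdisj (show j ≠ i₀ from hj).symm) hy₀ hyj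
  rcases isPreconnected_iff_subset_of_disjoint_closed.1 hs (F i₀) v (hF i₀) hvc hsub hint with
    h | h
  · exact h
  · -- `x ∈ v` contradicts disjointness with `F i₀ ∋ x`
    obtain ⟨j, hj, hxj⟩ := mem_iUnion₂.1 (h hx)
    exact absurd hxj (Set.disjoint_left.1 (hdisj (show j ≠ i₀ from hj).symm) hi₀)

/-- **Loops in an embedded simply connected set are null-homotopic**: if `f : Y → X` is an
embedding of a simply connected space and the loop `γ` at `x` runs inside `range f`, then `γ` is
homotopic to the constant loop in `X` (lift `γ` through the homeomorphism `Y ≃ₜ range f`, contract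
in `Y` by `SimplyConnectedSpace.paths_homotopic`, push forward by `f`). Continuous images do NOT
suffice (`ℝ → S¹`); the embedding is what the card's chart blocks provide. [folklore] -/
theorem Path.Homotopic.refl_of_range_subset_range_of_isEmbedding {Y : Type*} [TopologicalSpace Y]
    [SimplyConnectedSpace Y] {f : Y → X} (hf : IsEmbedding f) {x : X} (γ : Path x x)
    (hγ : range γ ⊆ range f) : γ.Homotopic (Path.refl x) := by
  obtain ⟨y, rfl⟩ : x ∈ range f := hγ ⟨0, γ.source⟩
  set e := hf.toHomeomorph with he
  have hval : ∀ p : range f, f (e.symm p) = (p : X) := fun p ↦ by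
    have h := congrArg Subtype.val (e.apply_symm_apply p)
    rwa [IsEmbedding.toHomeomorph_apply_coe] at h
  -- the lifted loop in `Y`
  let γY : Path y y :=
    { toFun := fun t ↦ e.symm ⟨γ t, hγ ⟨t, rfl⟩⟩
      continuous_toFun := e.symm.continuous.comp (γ.continuous.subtype_mk fun t ↦ hγ ⟨t, rfl⟩)
      source' := by
        have h0 : (⟨γ 0, hγ ⟨0, rfl⟩⟩ : range f) = ⟨f y, y, rfl⟩ := Subtype.ext γ.source
        simp only [h0]
        exact hf.toHomeomorph_symm_apply y
      target' := by
        have h1 : (⟨γ 1, hγ ⟨1, rfl⟩⟩ : range f) = ⟨f y, y, rfl⟩ := Subtype.ext γ.target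
        simp only [h1]
        exact hf.toHomeomorph_symm_apply y }
  have hY : γY.Homotopic (Path.refl y) := SimplyConnectedSpace.paths_homotopic _ _
  have hX := hY.map ⟨f, hf.continuous⟩
  have h1 : γY.map (⟨f, hf.continuous⟩ : C(Y, X)).continuous = γ := by
    ext t
    exact hval ⟨γ t, hγ ⟨t, rfl⟩⟩
  have h2 : (Path.refl y).map (⟨f, hf.continuous⟩ : C(Y, X)).continuous = Path.refl (f y) := by
    ext t
    rfl
  rwa [h1, h2] at hX

/-- **One block carries the loop, so the loop is inessential**: let `F i` (`i` in a finite type)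
be pairwise disjoint closed subsets of `X`, each of which kills the loops it contains (every loop
with range in `F i` is null-homotopic in `X` — e.g. `F i` the image of an embedding of a simply
connected space, `Path.Homotopic.refl_of_range_subset_range_of_isEmbedding`). Then every loop
covered by `⋃ i, F i` is null-homotopic in `X`: its range is connected, hence inside one block
(`subset_of_subset_iUnion_of_pairwise_disjoint_isClosed`). This is step (s3d) of the card: an
ESSENTIAL late loop cannot be covered by finitely many disjoint compact chart blocks. [folklore] -/
theorem Path.Homotopic.refl_of_range_subset_iUnion {ι : Type*} [Finite ι] {F : ι → Set X}
    (hF : ∀ i, IsClosed (F i)) (hdisj : Pairwise (Function.onFun Disjoint F))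
    (hkill : ∀ i, ∀ (x : X) (δ : Path x x), range δ ⊆ F i → δ.Homotopic (Path.refl x))
    {x : X} (γ : Path x x) (hγ : range γ ⊆ ⋃ i, F i) : γ.Homotopic (Path.refl x) := by
  obtain ⟨i, hi⟩ := subset_of_subset_iUnion_of_pairwise_disjoint_isClosed
    (isPreconnected_range γ.continuous) (range_nonempty γ) hF hdisj hγ
  exact hkill i x γ hi

/-- The embedded form of (s3d): pairwise disjoint closed blocks `range (f i)`, each the image of an
embedding of a simply connected space `Y i`, cover the loop `γ` ⇒ `γ` is null-homotopic. [folklore] -/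
theorem Path.Homotopic.refl_of_range_subset_iUnion_of_isEmbedding {ι : Type*} [Finite ι]
    {Y : ι → Type*} [∀ i, TopologicalSpace (Y i)] [∀ i, SimplyConnectedSpace (Y i)]
    {f : ∀ i, Y i → X} (hf : ∀ i, IsEmbedding (f i)) (hF : ∀ i, IsClosed (range (f i)))
    (hdisj : Pairwise (Function.onFun Disjoint fun i ↦ range (f i)))
    {x : X} (γ : Path x x) (hγ : range γ ⊆ ⋃ i, range (f i)) : γ.Homotopic (Path.refl x) :=
  Path.Homotopic.refl_of_range_subset_iUnion hF hdisj
    (fun i _ δ hδ ↦ Path.Homotopic.refl_of_range_subset_range_of_isEmbedding (hf i) δ hδ) γ hγ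

end Summit.FinalStateConjecture.FinalStateConjecture.Theorems.LaminatedThreshold.HorizonShadowedBag
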